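import Literature.NumberTheory.Sieve.LargestPrimeFactorCubicLemma10
import Literature.NumberTheory.Sieve.LargestPrimeFactorCubicTcountMoebius
import Literature.NumberTheory.Sieve.LargestPrimeFactorCubicCoprimeDensity
import Literature.NumberTheory.Sieve.LargestPrimeFactorCubicGcdTail
import Literature.NumberTheory.Sieve.LargestPrimeFactorCubicPairFibre
import Literature.NumberTheory.Sieve.LargestPrimeFactorCubicTauSums
import HarnessLib

/-!
# Heath-Brown 2001 (PLMS), Lemma 11 in root language:
# `∑_{r≤Q} ∑_{k³≡2 (r)} |T(r,k) − (6/π²) M² γ(r)/r| ≪ (N Q^{1/2} + N^{3/2}) N^ε`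

Topic `Literature/NumberTheory/Sieve`; a PROVED layer (no named facts) under the named fact
`Irving2015_largestPrimeFactor_cubic` (`LargestPrimeFactorCubic.lean`), assembling Heath-Brown's
**Lemma 11** from `…TcountMoebius` ((7.3)), `…CoprimeDensity` ((7.4)), `…GcdTail` ((7.5)),
`…PairFibre` (the passage `R ↦ R/(R,d)`), `…RootPairs` (the divisor count for (7.6)), `…TauSums`
and `…Lemma10`.  Source: D. R. Heath-Brown, *The largest prime factor of `X³ + 2`*, Proc. London
Math. Soc. (3) 82 (2001) 554–596, §7 pp. 25–27, Lemma 11: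

  `∑_{N(R)≤Q} |T(R) − (6/π²)(M²/N(R)) γ(R)ρ(R)| ≪ (N Q^{1/2} + N^{3/2}) N^ε`  (`Q ≤ N²`),
  `T(R) = #{A < a ≤ A+M, B < b ≤ B+M : (a,b) = 1, R ∣ a − b∛2}`, `γ(R) = ∏_{p∣N(R)}(1 + 1/p)⁻¹`,

for boxes with `A, B, M ≤ N` (and (2.21), automatic for `A, B ≥ 0`).  In root language (pairs
`(r, k) ∈ rootPairs Q` for the `R` with `ρ(R) = 1`; the others have `T(R) = 0` and do not occur):

  **`exists_sum_rootPairs_abs_Tcount_sub_le`**: for every `ε > 0` there is `C` with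
  `∑_{(r,k) ∈ rootPairs Q} |T(r,k;A,B,M) − (6/π²) M² γ(r)/r| ≤ C (N √Q + N^{3/2}) N^ε`
  for all `1 ≤ Q ≤ N²`, `A, B ≤ N`, `1 ≤ M ≤ N`.

Proof (pp. 25–27): `T = ∑_{d≤A+M} μ(d) S_d`, `S_d = S(r/(r,d), k; A/d, U₁, B/d, U₂)` with
`U_i = M/d + O(1)`; the main term is `(M²/r) ∑_d μ(d)(r,d)/d²`; split at `Δ = min(√N, N/√Q, A+M)`:
`d ≤ Δ` by Lemma 10 after regrouping (fibres `≤ s = (r,d)`), the box-shape error `|U₁U₂ − (M/d)²| ≤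
2M/d + 1`, `d > Δ` by the divisor count (`r ∣ d(a₁ − b₁k) ⇒ r ∣ (da₁)³ − 2(db₁)³`), and the tail of
the main term by (7.5).
-/

noncomputable section

open Finset Real Filter ArithmeticFunction
open scoped ArithmeticFunction.Moebius

namespace Literature.NumberTheory.Sieve.HeathBrown2001

/-! ### Part A: the box `(A, A+M]/d`, the counts `S_d`, and the decomposition -/

/-- The side `U(A, M, d) = ⌊(A+M)/d⌋ − ⌊A/d⌋ ∈ [M/d − 1, M/d + 1]` of the divided box. [folklore] -/
def Uside (A M d : ℕ) : ℕ := (A + M) / d - A / d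

/-- `(A/d, (A+M)/d] = (A/d, A/d + U]`. [folklore] -/
theorem Ioc_div_eq (A M d : ℕ) : Ioc (A / d) ((A + M) / d) = Ioc (A / d) (A / d + Uside A M d) := by
  rw [Uside, Nat.add_sub_cancel' (Nat.div_le_div_right (Nat.le_add_right A M))]

/-- `|U − M/d| ≤ 1` (`d ≥ 1`). [folklore] -/
theorem abs_Uside_sub_le {d : ℕ} (hd : 0 < d) (A M : ℕ) : |(Uside A M d : ℝ) - (M : ℝ) / d| ≤ 1 := by
  have hd' : (0 : ℝ) < d := by exact_mod_cast hd
  have h1 : ((A + M) / d : ℕ) * d ≤ A + M := Nat.div_mul_le_self _ _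
  have h2 : A + M < ((A + M) / d + 1) * d := (Nat.div_lt_iff_lt_mul hd).mp (Nat.lt_succ_self _)
  have h3 : (A / d : ℕ) * d ≤ A := Nat.div_mul_le_self _ _
  have h4 : A < (A / d + 1) * d := (Nat.div_lt_iff_lt_mul hd).mp (Nat.lt_succ_self _)
  have hle : A / d ≤ (A + M) / d := Nat.div_le_div_right (Nat.le_add_right A M)
  have hU : ((Uside A M d : ℕ) : ℝ) = (((A + M) / d : ℕ) : ℝ) - ((A / d : ℕ) : ℝ) := by
    rw [Uside]; push_cast [Nat.cast_sub hle]; ring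
  have h1' : (((A + M) / d : ℕ) : ℝ) * d ≤ A + M := by exact_mod_cast h1
  have h2' : (A : ℝ) + M < ((((A + M) / d : ℕ) : ℝ) + 1) * d := by exact_mod_cast h2
  have h3' : ((A / d : ℕ) : ℝ) * d ≤ A := by exact_mod_cast h3
  have h4' : (A : ℝ) < (((A / d : ℕ) : ℝ) + 1) * d := by exact_mod_cast h4
  have h5 : ((M : ℝ) - d) ≤ ((((A + M) / d : ℕ) : ℝ) - ((A / d : ℕ) : ℝ)) * d := by nlinarith
  have h6 : ((((A + M) / d : ℕ) : ℝ) - ((A / d : ℕ) : ℝ)) * d ≤ (M : ℝ) + d := by nlinarith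
  rw [hU, abs_le]
  constructor
  · have : (M : ℝ) / d - 1 ≤ (((A + M) / d : ℕ) : ℝ) - ((A / d : ℕ) : ℝ) := by
      rw [div_sub_one hd'.ne', div_le_iff₀ hd']; linarith
    linarith
  · have : (((A + M) / d : ℕ) : ℝ) - ((A / d : ℕ) : ℝ) ≤ (M : ℝ) / d + 1 := by
      rw [div_add_one hd'.ne', le_div_iff₀ hd']; linarith
    linarith

/-- Hence `|U₁U₂ − (M/d)²| ≤ 2M/d + 1`. [cite: HeathBrown2001LargestPrimeFactorCubic, §7 (7.3) ("M′ = M/d")] -/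
theorem abs_Uside_mul_sub_le {d : ℕ} (hd : 0 < d) (A B M : ℕ) :
    |(Uside A M d : ℝ) * Uside B M d - ((M : ℝ) / d) ^ 2| ≤ 2 * ((M : ℝ) / d) + 1 := by
  have h1 := abs_Uside_sub_le hd A M
  have h2 := abs_Uside_sub_le hd B M
  have hM : 0 ≤ (M : ℝ) / d := by positivity
  have e : (Uside A M d : ℝ) * Uside B M d - ((M : ℝ) / d) ^ 2 =
      (M : ℝ) / d * (((Uside A M d : ℝ) - (M : ℝ) / d) + ((Uside B M d : ℝ) - (M : ℝ) / d)) +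
        ((Uside A M d : ℝ) - (M : ℝ) / d) * ((Uside B M d : ℝ) - (M : ℝ) / d) := by ring
  rw [e]
  obtain ⟨hθ1, hθ2⟩ := abs_le.mp h1
  obtain ⟨hθ1', hθ2'⟩ := abs_le.mp h2
  have hprod : |((Uside A M d : ℝ) - (M : ℝ) / d) * ((Uside B M d : ℝ) - (M : ℝ) / d)| ≤ 1 := by
    rw [abs_mul]; exact mul_le_one₀ h1 (abs_nonneg _) h2
  obtain ⟨hp1, hp2⟩ := abs_le.mp hprod
  rw [abs_le]
  constructor <;> nlinarith [mul_le_mul_of_nonneg_left hθ1 hM, mul_le_mul_of_nonneg_left hθ1' hM,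
    mul_le_mul_of_nonneg_left hθ2 hM, mul_le_mul_of_nonneg_left hθ2' hM]

/-- `S(r′, k mod r′; …) = S(r′, k; …)`: the count depends on `k` only modulo the modulus. [folklore] -/
theorem Scount₂_mod (r' k A U₁ B U₂ : ℕ) : Scount₂ r' (k % r') A U₁ B U₂ = Scount₂ r' k A U₁ B U₂ := by
  unfold Scount₂
  congr 1
  refine filter_congr fun ab _ => ?_
  have h : ((r' : ℕ) : ℤ) ∣ (ab.2 : ℤ) * k - (ab.2 : ℤ) * ((k % r' : ℕ) : ℤ) := by
    rw [← mul_sub, Int.natCast_mod]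
    exact dvd_mul_of_dvd_right Int.dvd_self_sub_emod _
  constructor
  · intro h1
    have h2 := dvd_sub h1 h
    rwa [show (ab.1 : ℤ) - ab.2 * ((k % r' : ℕ) : ℤ) - ((ab.2 : ℤ) * k - ab.2 * ((k % r' : ℕ) : ℤ)) =
      (ab.1 : ℤ) - ab.2 * k by ring] at h2
  · intro h1
    have h2 := dvd_add h1 h
    rwa [show (ab.1 : ℤ) - ab.2 * k + ((ab.2 : ℤ) * k - ab.2 * ((k % r' : ℕ) : ℤ)) =
      (ab.1 : ℤ) - ab.2 * ((k % r' : ℕ) : ℤ) by ring] at h2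

/-- `S_d(r, k) = S(r/(r,d), k; A/d, U₁, B/d, U₂)`. [cite: HeathBrown2001LargestPrimeFactorCubic, §7 (7.3)] -/
def Sd (A B M r k d : ℕ) : ℕ := Scount₂ (r / Nat.gcd r d) k (A / d) (Uside A M d) (B / d) (Uside B M d)

/-- **(7.3)**: `T(r,k) = ∑_{d=1}^{A+M} μ(d) S_d(r,k)` (real form). [cite: HeathBrown2001LargestPrimeFactorCubic, §7 (7.3)] -/
theorem Tcount_eq_sum_Sd {r : ℕ} (hr : 0 < r) (k A B M : ℕ) :
    (Tcount r k A B M : ℝ) = ∑ d ∈ Icc 1 (A + M), (μ d : ℝ) * (Sd A B M r k d : ℝ) := by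
  have h := Tcount_eq_sum_moebius hr k A B M
  have hZ : (Tcount r k A B M : ℤ) = ∑ d ∈ Icc 1 (A + M), (μ d : ℤ) * (Sd A B M r k d : ℤ) := by
    rw [h]
    refine sum_congr rfl fun d _ => ?_
    rw [Sd, Scount₂, Ioc_div_eq A M d, Ioc_div_eq B M d]
  have hR := congrArg (Int.cast : ℤ → ℝ) hZ
  push_cast at hR
  exact hR

/-! ### Part B: the main term as `(M²/r) ∑_d μ(d)(r,d)/d²` and the per-pair decomposition -/

/-- `(M/d)²/(r/(r,d)) = (M²/r) · (r,d)/d²` (`r, d ≥ 1`). [folklore] -/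
theorem sq_div_eq {r d : ℕ} (hr : 0 < r) (hd : 0 < d) (M : ℝ) :
    (M / d) ^ 2 / ((r / Nat.gcd r d : ℕ) : ℝ) = M ^ 2 / r * ((Nat.gcd r d : ℝ) / (d : ℝ) ^ 2) := by
  have hg : 0 < Nat.gcd r d := Nat.gcd_pos_of_pos_left _ hr
  have hgr : Nat.gcd r d ∣ r := Nat.gcd_dvd_left r d
  have hcast : ((r / Nat.gcd r d : ℕ) : ℝ) = (r : ℝ) / (Nat.gcd r d : ℝ) := by
    rw [Nat.cast_div hgr (by exact_mod_cast hg.ne')]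
  rw [hcast]
  have hr' : (0 : ℝ) < r := by exact_mod_cast hr
  have hd' : (0 : ℝ) < d := by exact_mod_cast hd
  have hg' : (0 : ℝ) < Nat.gcd r d := by exact_mod_cast hg
  field_simp

set_option maxHeartbeats 800000 in
/-- The tail of the main-term series: `∑'_{d > Δ} |μ(d)(r,d)/d²| ≤ 2τ(r)/Δ` (`r, Δ ≥ 1`).
[cite: HeathBrown2001LargestPrimeFactorCubic, §7 (7.5)] -/
theorem tsum_abs_mobGcd_tail_le {r Δ : ℕ} (hr : 0 < r) (hΔ : 0 < Δ) :
    Summable (fun n : ℕ => |mobGcd r (n + (Δ + 1))|) ∧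
      ∑' n : ℕ, |mobGcd r (n + (Δ + 1))| ≤ 2 * (#r.divisors : ℝ) / Δ := by
  have hs : Summable fun d : ℕ => |mobGcd r d| := by
    simpa only [Real.norm_eq_abs] using summable_norm_mobGcd hr
  have hs' : Summable (fun n : ℕ => |mobGcd r (n + (Δ + 1))|) :=
    (summable_nat_add_iff (f := fun d : ℕ => |mobGcd r d|) (Δ + 1)).mpr hs
  refine ⟨hs', ?_⟩
  -- partial sums are `∑_{d ∈ Ioc Δ (Δ+n)} |mobGcd r d| ≤ ∑ (r,d)/d² ≤ 2τ(r)/Δ`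
  refine Real.tsum_le_of_sum_range_le (fun _ => abs_nonneg _) fun n => ?_
  have hshift : ∑ i ∈ Finset.range n, |mobGcd r (i + (Δ + 1))| = ∑ d ∈ Ioc Δ (Δ + n), |mobGcd r d| := by
    induction n with
    | zero => simp
    | succ n ih =>
        rw [Finset.sum_range_succ, ih, show Δ + (n + 1) = (Δ + n) + 1 by ring,
          Finset.sum_Ioc_succ_top (by omega : Δ ≤ Δ + n), show n + (Δ + 1) = Δ + n + 1 by ring]
  rw [hshift]
  calc ∑ d ∈ Ioc Δ (Δ + n), |mobGcd r d| ≤ ∑ d ∈ Ioc Δ (Δ + n), (Nat.gcd r d : ℝ) / (d : ℝ) ^ 2 := by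
        refine sum_le_sum fun d hd => ?_
        rw [mem_Ioc] at hd
        rw [mobGcd_apply, abs_div, abs_mul, abs_of_nonneg (by positivity : (0 : ℝ) ≤ (d : ℝ) ^ 2),
          Nat.abs_cast]
        have h1 : |(μ d : ℝ)| ≤ 1 := by exact_mod_cast abs_moebius_le_one (n := d)
        have : |(μ d : ℝ)| * (Nat.gcd r d : ℝ) ≤ (Nat.gcd r d : ℝ) := by
          calc |(μ d : ℝ)| * (Nat.gcd r d : ℝ) ≤ 1 * (Nat.gcd r d : ℝ) := by gcongr
            _ = _ := one_mul _
        exact div_le_div_of_nonneg_right this (by positivity)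
    _ ≤ 2 * (#r.divisors : ℝ) / Δ := sum_Ioc_gcd_div_sq_le hr hΔ _

set_option maxHeartbeats 1600000 in
/-- **Per-pair decomposition**: for `r ≥ 1`, `1 ≤ Δ ≤ A + M`,
`|T(r,k) − (6/π²)M²γ(r)/r| ≤ ∑_{d≤Δ} |S_d − U₁U₂/r_d| + ∑_{d≤Δ} (2M/d + 1)/r_d + ∑_{Δ<d≤A+M} S_d + (M²/r)(2τ(r)/Δ)`,
`r_d = r/(r,d)`. [cite: HeathBrown2001LargestPrimeFactorCubic, §7 pp. 25–26 ((7.3)–(7.6))] -/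
theorem abs_Tcount_sub_main_le {r Δ A B M : ℕ} (hr : 0 < r) (hΔ : 0 < Δ) (hΔL : Δ ≤ A + M) (k : ℕ) :
    |(Tcount r k A B M : ℝ) - 6 / Real.pi ^ 2 * (M : ℝ) ^ 2 * gammaR r / r| ≤
      ∑ d ∈ Icc 1 Δ, |(Sd A B M r k d : ℝ) - (Uside A M d : ℝ) * (Uside B M d) / ((r / Nat.gcd r d : ℕ) : ℝ)| +
        ∑ d ∈ Icc 1 Δ, (2 * ((M : ℝ) / d) + 1) / ((r / Nat.gcd r d : ℕ) : ℝ) +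
        ∑ d ∈ Ioc Δ (A + M), (Sd A B M r k d : ℝ) +
        (M : ℝ) ^ 2 / r * (2 * (#r.divisors : ℝ) / Δ) := by
  have hr' : (0 : ℝ) < r := by exact_mod_cast hr
  -- Step 1: `T = ∑_{d ≤ Δ} μ S_d + ∑_{Δ < d ≤ A+M} μ S_d`
  have hT := Tcount_eq_sum_Sd hr k A B M
  have hsplit : Icc 1 (A + M) = Icc 1 Δ ∪ Ioc Δ (A + M) := by
    ext d; simp only [mem_union, mem_Icc, mem_Ioc]; omega
  have hdisj : Disjoint (Icc 1 Δ) (Ioc Δ (A + M)) := by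
    rw [disjoint_left]; intro d h1 h2; simp only [mem_Icc, mem_Ioc] at h1 h2; omega
  rw [hsplit, sum_union hdisj] at hT
  -- Step 2: the main term `= (M²/r)(∑_{d≤Δ} mobGcd + tail)`
  have hmain := tsum_mobGcd hr
  have hs : Summable fun d : ℕ => mobGcd r d := (summable_norm_mobGcd hr).of_norm
  have htsum_split : ∑' d : ℕ, mobGcd r d = ∑ d ∈ Finset.range (Δ + 1), mobGcd r d + ∑' n : ℕ, mobGcd r (n + (Δ + 1)) :=
    (hs.sum_add_tsum_nat_add (Δ + 1)).symm
  have hrange : ∑ d ∈ Finset.range (Δ + 1), mobGcd r d = ∑ d ∈ Icc 1 Δ, mobGcd r d := by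
    rw [Finset.range_eq_Ico, show Finset.Ico 0 (Δ + 1) = insert 0 (Icc 1 Δ) by ext d; simp only [mem_Ico, mem_insert, mem_Icc]; omega,
      sum_insert (by simp), show mobGcd r 0 = 0 by simp, zero_add]
  obtain ⟨-, htail⟩ := tsum_abs_mobGcd_tail_le hr hΔ
  have htail' : |∑' n : ℕ, mobGcd r (n + (Δ + 1))| ≤ 2 * (#r.divisors : ℝ) / Δ := by
    refine (norm_tsum_le_tsum_norm ((summable_nat_add_iff (f := fun d : ℕ => ‖mobGcd r d‖) (Δ + 1)).mpr
      (summable_norm_mobGcd hr))).trans ?_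
    simpa only [Real.norm_eq_abs] using htail
  -- main = (M²/r) * tsum
  have hmainval : 6 / Real.pi ^ 2 * (M : ℝ) ^ 2 * gammaR r / r = (M : ℝ) ^ 2 / r * ∑' d : ℕ, mobGcd r d := by
    rw [hmain]; ring
  -- Step 3: `∑_{d≤Δ} μ(d) (M/d)²/r_d = (M²/r) ∑_{d≤Δ} mobGcd`
  have hmid : ∑ d ∈ Icc 1 Δ, (μ d : ℝ) * ((M : ℝ) / d) ^ 2 / ((r / Nat.gcd r d : ℕ) : ℝ) =
      (M : ℝ) ^ 2 / r * ∑ d ∈ Icc 1 Δ, mobGcd r d := by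
    rw [mul_sum]
    refine sum_congr rfl fun d hd => ?_
    rw [mem_Icc] at hd
    rw [mul_div_assoc, sq_div_eq hr (by omega) (M : ℝ), mobGcd_apply]
    ring
  -- Step 4: algebra — write `T − main` as the four pieces
  have hdecomp : (Tcount r k A B M : ℝ) - 6 / Real.pi ^ 2 * (M : ℝ) ^ 2 * gammaR r / r =
      ∑ d ∈ Icc 1 Δ, (μ d : ℝ) * ((Sd A B M r k d : ℝ) - (Uside A M d : ℝ) * (Uside B M d) / ((r / Nat.gcd r d : ℕ) : ℝ)) +
      ∑ d ∈ Icc 1 Δ, (μ d : ℝ) * (((Uside A M d : ℝ) * (Uside B M d) - ((M : ℝ) / d) ^ 2) / ((r / Nat.gcd r d : ℕ) : ℝ)) +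
      ∑ d ∈ Ioc Δ (A + M), (μ d : ℝ) * (Sd A B M r k d : ℝ) -
      (M : ℝ) ^ 2 / r * ∑' n : ℕ, mobGcd r (n + (Δ + 1)) := by
    rw [hT, hmainval, htsum_split, hrange]
    have e1 : ∑ d ∈ Icc 1 Δ, (μ d : ℝ) * (Sd A B M r k d : ℝ) =
        ∑ d ∈ Icc 1 Δ, (μ d : ℝ) * ((Sd A B M r k d : ℝ) - (Uside A M d : ℝ) * (Uside B M d) / ((r / Nat.gcd r d : ℕ) : ℝ)) +
        ∑ d ∈ Icc 1 Δ, (μ d : ℝ) * (((Uside A M d : ℝ) * (Uside B M d) - ((M : ℝ) / d) ^ 2) / ((r / Nat.gcd r d : ℕ) : ℝ)) +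
        ∑ d ∈ Icc 1 Δ, (μ d : ℝ) * ((M : ℝ) / d) ^ 2 / ((r / Nat.gcd r d : ℕ) : ℝ) := by
      rw [← sum_add_distrib, ← sum_add_distrib]
      refine sum_congr rfl fun d _ => ?_
      ring
    rw [e1, hmid]
    ring
  rw [hdecomp]
  -- Step 5: bound each piece
  have hμ : ∀ d : ℕ, |(μ d : ℝ)| ≤ 1 := fun d => by exact_mod_cast abs_moebius_le_one (n := d)
  have b1 : |∑ d ∈ Icc 1 Δ, (μ d : ℝ) * ((Sd A B M r k d : ℝ) - (Uside A M d : ℝ) * (Uside B M d) / ((r / Nat.gcd r d : ℕ) : ℝ))| ≤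
      ∑ d ∈ Icc 1 Δ, |(Sd A B M r k d : ℝ) - (Uside A M d : ℝ) * (Uside B M d) / ((r / Nat.gcd r d : ℕ) : ℝ)| := by
    refine (abs_sum_le_sum_abs _ _).trans (sum_le_sum fun d _ => ?_)
    rw [abs_mul]
    calc |(μ d : ℝ)| * _ ≤ 1 * _ := mul_le_mul_of_nonneg_right (hμ d) (abs_nonneg _)
      _ = _ := one_mul _
  have b2 : |∑ d ∈ Icc 1 Δ, (μ d : ℝ) * (((Uside A M d : ℝ) * (Uside B M d) - ((M : ℝ) / d) ^ 2) / ((r / Nat.gcd r d : ℕ) : ℝ))| ≤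
      ∑ d ∈ Icc 1 Δ, (2 * ((M : ℝ) / d) + 1) / ((r / Nat.gcd r d : ℕ) : ℝ) := by
    refine (abs_sum_le_sum_abs _ _).trans (sum_le_sum fun d hd => ?_)
    rw [mem_Icc] at hd
    have hrd : (0 : ℝ) < ((r / Nat.gcd r d : ℕ) : ℝ) := by
      have : 0 < r / Nat.gcd r d := Nat.div_pos (Nat.le_of_dvd hr (Nat.gcd_dvd_left r d)) (Nat.gcd_pos_of_pos_left _ hr)
      exact_mod_cast this
    rw [abs_mul, abs_div, abs_of_pos hrd]
    have hU := abs_Uside_mul_sub_le (by omega : 0 < d) A B M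
    calc |(μ d : ℝ)| * (|(Uside A M d : ℝ) * (Uside B M d) - ((M : ℝ) / d) ^ 2| / ((r / Nat.gcd r d : ℕ) : ℝ))
        ≤ 1 * ((2 * ((M : ℝ) / d) + 1) / ((r / Nat.gcd r d : ℕ) : ℝ)) := by
          apply mul_le_mul (hμ d) _ (by positivity) zero_le_one
          exact div_le_div_of_nonneg_right hU hrd.le
      _ = _ := one_mul _
  have b3 : |∑ d ∈ Ioc Δ (A + M), (μ d : ℝ) * (Sd A B M r k d : ℝ)| ≤ ∑ d ∈ Ioc Δ (A + M), (Sd A B M r k d : ℝ) := by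
    refine (abs_sum_le_sum_abs _ _).trans (sum_le_sum fun d _ => ?_)
    rw [abs_mul, Nat.abs_cast]
    calc |(μ d : ℝ)| * (Sd A B M r k d : ℝ) ≤ 1 * (Sd A B M r k d : ℝ) := mul_le_mul_of_nonneg_right (hμ d) (by positivity)
      _ = _ := one_mul _
  have b4 : |(M : ℝ) ^ 2 / r * ∑' n : ℕ, mobGcd r (n + (Δ + 1))| ≤ (M : ℝ) ^ 2 / r * (2 * (#r.divisors : ℝ) / Δ) := by
    rw [abs_mul, abs_of_nonneg (by positivity : (0 : ℝ) ≤ (M : ℝ) ^ 2 / r)]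
    exact mul_le_mul_of_nonneg_left htail' (by positivity)
  calc |∑ d ∈ Icc 1 Δ, (μ d : ℝ) * ((Sd A B M r k d : ℝ) - (Uside A M d : ℝ) * (Uside B M d) / ((r / Nat.gcd r d : ℕ) : ℝ)) +
        ∑ d ∈ Icc 1 Δ, (μ d : ℝ) * (((Uside A M d : ℝ) * (Uside B M d) - ((M : ℝ) / d) ^ 2) / ((r / Nat.gcd r d : ℕ) : ℝ)) +
        ∑ d ∈ Ioc Δ (A + M), (μ d : ℝ) * (Sd A B M r k d : ℝ) -
        (M : ℝ) ^ 2 / r * ∑' n : ℕ, mobGcd r (n + (Δ + 1))|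
      ≤ |∑ d ∈ Icc 1 Δ, (μ d : ℝ) * ((Sd A B M r k d : ℝ) - (Uside A M d : ℝ) * (Uside B M d) / ((r / Nat.gcd r d : ℕ) : ℝ))| +
        |∑ d ∈ Icc 1 Δ, (μ d : ℝ) * (((Uside A M d : ℝ) * (Uside B M d) - ((M : ℝ) / d) ^ 2) / ((r / Nat.gcd r d : ℕ) : ℝ))| +
        |∑ d ∈ Ioc Δ (A + M), (μ d : ℝ) * (Sd A B M r k d : ℝ)| +
        |(M : ℝ) ^ 2 / r * ∑' n : ℕ, mobGcd r (n + (Δ + 1))| := by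
          refine (abs_sub _ _).trans ?_
          gcongr
          exact abs_add_three _ _ _
    _ ≤ _ := by linarith [b1, b2, b3, b4]


/-! ### Part C: the four pieces summed over the root pairs `(r, k) ∈ rootPairs Q` -/

/-- `S_d(r,k)` depends on `k` only modulo `r/(r,d)`. [folklore] -/
theorem Sd_eq_mod (A B M r k d : ℕ) :
    Sd A B M r k d = Scount₂ (r / Nat.gcd r d) (k % (r / Nat.gcd r d)) (A / d) (Uside A M d) (B / d) (Uside B M d) := by
  rw [Sd, Scount₂_mod]

/-- `∑_{s∣d} s (U + Q/s) ≤ σ(d) U + τ(d) Q`. [folklore] -/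
theorem sum_divisors_mul_add_le (d Q : ℕ) (U : ℝ) :
    ∑ s ∈ d.divisors, (s : ℝ) * (U + ((Q / s : ℕ) : ℝ)) ≤
      ((∑ s ∈ d.divisors, s : ℕ) : ℝ) * U + (#d.divisors : ℝ) * Q := by
  have h : ∀ s ∈ d.divisors, (s : ℝ) * (U + ((Q / s : ℕ) : ℝ)) ≤ (s : ℝ) * U + Q := by
    intro s hs
    have hs0 : 0 < s := Nat.pos_of_mem_divisors hs
    have h1 : (s : ℝ) * ((Q / s : ℕ) : ℝ) ≤ Q := by
      have : ((Q / s : ℕ) : ℝ) ≤ (Q : ℝ) / s := Nat.cast_div_le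
      have hs' : (0 : ℝ) < s := by exact_mod_cast hs0
      calc (s : ℝ) * ((Q / s : ℕ) : ℝ) ≤ (s : ℝ) * ((Q : ℝ) / s) := mul_le_mul_of_nonneg_left this hs'.le
        _ = Q := by field_simp
    nlinarith
  calc ∑ s ∈ d.divisors, (s : ℝ) * (U + ((Q / s : ℕ) : ℝ)) ≤ ∑ s ∈ d.divisors, ((s : ℝ) * U + Q) := sum_le_sum h
    _ = ((∑ s ∈ d.divisors, s : ℕ) : ℝ) * U + (#d.divisors : ℝ) * Q := by
        rw [sum_add_distrib, sum_const, nsmul_eq_mul, Nat.cast_sum, sum_mul]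

/-- **P1** (`d ≤ Δ`, via Lemma 10 after regrouping): with the constant `C` of Lemma 10 at `ε`,
`∑_{(r,k)} |S_d − U₁U₂/r_d| ≤ C Q^ε (σ(d)(U₂ + 1) + τ(d) Q)` (`d, Q ≥ 1`; `U₂ = Uside B M d`).
[cite: HeathBrown2001LargestPrimeFactorCubic, §7 p. 26] -/
theorem sum_P1_le {ε C : ℝ} (hε : 0 < ε) (hC : 0 < C)
    (hL10 : ∀ Q : ℕ, 1 ≤ Q → ∀ A U₁ B U₂ : ℕ,
      ∑ qk ∈ rootPairs Q, |(Scount₂ qk.1 qk.2 A U₁ B U₂ : ℝ) - (U₁ : ℝ) * U₂ / qk.1| ≤ C * ((U₂ : ℝ) + Q) * (Q : ℝ) ^ ε)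
    {Q d : ℕ} (hQ : 1 ≤ Q) (hd : 0 < d) (A B M : ℕ) :
    ∑ qk ∈ rootPairs Q, |(Sd A B M qk.1 qk.2 d : ℝ) - (Uside A M d : ℝ) * (Uside B M d) / ((qk.1 / Nat.gcd qk.1 d : ℕ) : ℝ)| ≤
      C * (Q : ℝ) ^ ε * (((∑ s ∈ d.divisors, s : ℕ) : ℝ) * (Uside B M d) + (#d.divisors : ℝ) * Q) := by
  have hQ0 : (0 : ℝ) < Q := by exact_mod_cast hQ
  set F : ℕ → ℕ → ℝ := fun r' k' =>
    |(Scount₂ r' k' (A / d) (Uside A M d) (B / d) (Uside B M d) : ℝ) - (Uside A M d : ℝ) * (Uside B M d) / r'| with hF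
  have hF0 : ∀ r' k', 0 ≤ F r' k' := fun _ _ => abs_nonneg _
  have hstep : ∑ qk ∈ rootPairs Q, |(Sd A B M qk.1 qk.2 d : ℝ) - (Uside A M d : ℝ) * (Uside B M d) / ((qk.1 / Nat.gcd qk.1 d : ℕ) : ℝ)| =
      ∑ qk ∈ rootPairs Q, F (qk.1 / Nat.gcd qk.1 d) (qk.2 % (qk.1 / Nat.gcd qk.1 d)) := by
    refine sum_congr rfl fun qk _ => ?_
    rw [hF, Sd_eq_mod]
  rw [hstep]
  refine (sum_rootPairs_comp_le hd F hF0).trans ?_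
  -- each inner sum by Lemma 10 at `Q/s`
  have hinner : ∀ s ∈ d.divisors, ∑ qk ∈ rootPairs (Q / s), F qk.1 qk.2 ≤
      C * (Q : ℝ) ^ ε * ((Uside B M d : ℝ) + ((Q / s : ℕ) : ℝ)) := by
    intro s hs
    rcases Nat.eq_zero_or_pos (Q / s) with h0 | hpos
    · rw [h0]
      have : rootPairs 0 = ∅ := by unfold rootPairs; simp
      rw [this, sum_empty]; positivity
    · have h := hL10 (Q / s) hpos (A / d) (Uside A M d) (B / d) (Uside B M d)
      refine h.trans ?_
      have hQs : ((Q / s : ℕ) : ℝ) ≤ Q := by exact_mod_cast Nat.div_le_self Q s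
      have hQs1 : (1 : ℝ) ≤ ((Q / s : ℕ) : ℝ) := by exact_mod_cast hpos
      have hpow : ((Q / s : ℕ) : ℝ) ^ ε ≤ (Q : ℝ) ^ ε := Real.rpow_le_rpow (by positivity) hQs hε.le
      have hU : 0 ≤ (Uside B M d : ℝ) + ((Q / s : ℕ) : ℝ) := by positivity
      calc C * ((Uside B M d : ℝ) + ((Q / s : ℕ) : ℝ)) * ((Q / s : ℕ) : ℝ) ^ ε
          ≤ C * ((Uside B M d : ℝ) + ((Q / s : ℕ) : ℝ)) * (Q : ℝ) ^ ε := by gcongr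
        _ = C * (Q : ℝ) ^ ε * ((Uside B M d : ℝ) + ((Q / s : ℕ) : ℝ)) := by ring
  calc ∑ s ∈ d.divisors, (s : ℝ) * ∑ qk ∈ rootPairs (Q / s), F qk.1 qk.2
      ≤ ∑ s ∈ d.divisors, (s : ℝ) * (C * (Q : ℝ) ^ ε * ((Uside B M d : ℝ) + ((Q / s : ℕ) : ℝ))) :=
        sum_le_sum fun s hs => mul_le_mul_of_nonneg_left (hinner s hs) (Nat.cast_nonneg _)
    _ = C * (Q : ℝ) ^ ε * ∑ s ∈ d.divisors, (s : ℝ) * ((Uside B M d : ℝ) + ((Q / s : ℕ) : ℝ)) := by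
        rw [mul_sum]; exact sum_congr rfl fun s _ => by ring
    _ ≤ C * (Q : ℝ) ^ ε * (((∑ s ∈ d.divisors, s : ℕ) : ℝ) * (Uside B M d) + (#d.divisors : ℝ) * Q) := by
        gcongr; exact sum_divisors_mul_add_le d Q _

/-- `∑_{(r',k') ∈ rootPairs Q'} 1/r' ≤ C_r Q^{ε} (1 + log Q)` for `Q' ≤ Q`, given `#rootsCube r ≤ C_r r^ε`. [folklore] -/
theorem sum_rootPairs_inv_le {Cr ε : ℝ} (hCr : 0 ≤ Cr) (hε : 0 ≤ ε)
    (hroot : ∀ q : ℕ, q ≠ 0 → (#(rootsCube q) : ℝ) ≤ Cr * (q : ℝ) ^ ε) {Q Q' : ℕ} (hQ' : Q' ≤ Q) :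
    ∑ qk ∈ rootPairs Q', (1 : ℝ) / qk.1 ≤ Cr * (Q : ℝ) ^ ε * (1 + Real.log Q) := by
  unfold rootPairs
  rw [sum_sigma]
  have h1 : ∑ r ∈ Icc 1 Q', ∑ _k ∈ rootsCube r, (1 : ℝ) / r = ∑ r ∈ Icc 1 Q', (#(rootsCube r) : ℝ) / r := by
    refine sum_congr rfl fun r _ => ?_
    rw [sum_const, nsmul_eq_mul, mul_one_div]
  rw [h1]
  calc ∑ r ∈ Icc 1 Q', (#(rootsCube r) : ℝ) / r ≤ ∑ r ∈ Icc 1 Q, (#(rootsCube r) : ℝ) / r :=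
        sum_le_sum_of_subset_of_nonneg (Icc_subset_Icc_right hQ') fun _ _ _ => by positivity
    _ ≤ (Cr * (Q : ℝ) ^ ε) * (1 + Real.log Q) := by
        refine sum_Icc_div_le_mul_log (fun r hr => ?_) (by positivity)
        rw [mem_Icc] at hr
        calc (#(rootsCube r) : ℝ) ≤ Cr * (r : ℝ) ^ ε := hroot r (by omega)
          _ ≤ Cr * (Q : ℝ) ^ ε := by gcongr; exact_mod_cast hr.2
    _ = Cr * (Q : ℝ) ^ ε * (1 + Real.log Q) := by ring

/-- **P2** (the box-shape error): `∑_{(r,k)} (2M/d + 1)/r_d ≤ (2M/d + 1) σ(d) C_r Q^ε (1 + log Q)`.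
[cite: HeathBrown2001LargestPrimeFactorCubic, §7 p. 26] -/
theorem sum_P2_le {Cr ε : ℝ} (hCr : 0 ≤ Cr) (hε : 0 ≤ ε)
    (hroot : ∀ q : ℕ, q ≠ 0 → (#(rootsCube q) : ℝ) ≤ Cr * (q : ℝ) ^ ε) {Q d : ℕ} (hd : 0 < d) (M : ℕ) :
    ∑ qk ∈ rootPairs Q, (2 * ((M : ℝ) / d) + 1) / ((qk.1 / Nat.gcd qk.1 d : ℕ) : ℝ) ≤
      (2 * ((M : ℝ) / d) + 1) * ((∑ s ∈ d.divisors, s : ℕ) : ℝ) * (Cr * (Q : ℝ) ^ ε * (1 + Real.log Q)) := by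
  have hM : 0 ≤ 2 * ((M : ℝ) / d) + 1 := by positivity
  have h1 : ∑ qk ∈ rootPairs Q, (2 * ((M : ℝ) / d) + 1) / ((qk.1 / Nat.gcd qk.1 d : ℕ) : ℝ) =
      (2 * ((M : ℝ) / d) + 1) * ∑ qk ∈ rootPairs Q, (fun r' _k' : ℕ => (1 : ℝ) / r') (qk.1 / Nat.gcd qk.1 d) (qk.2 % (qk.1 / Nat.gcd qk.1 d)) := by
    rw [mul_sum]; exact sum_congr rfl fun qk _ => by ring
  rw [h1, mul_assoc]
  refine mul_le_mul_of_nonneg_left ?_ hM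
  refine (sum_rootPairs_comp_le hd (fun r' _ => (1 : ℝ) / r') fun _ _ => by positivity).trans ?_
  rw [Nat.cast_sum, sum_mul]
  refine sum_le_sum fun s hs => ?_
  exact mul_le_mul_of_nonneg_left (sum_rootPairs_inv_le hCr hε hroot (Nat.div_le_self Q s)) (Nat.cast_nonneg _)

/-- `S_d(r,k) ≤ #{(a₁,b₁) ∈ box_d : r ∣ d(a₁ − b₁k)}` — indeed equality (`r/(r,d) ∣ x ↔ r ∣ dx`). [folklore] -/
theorem Sd_eq_card (A B M r k d : ℕ) (hr : 0 < r) :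
    Sd A B M r k d = #((Ioc (A / d) (A / d + Uside A M d) ×ˢ Ioc (B / d) (B / d + Uside B M d)).filter
      fun ab : ℕ × ℕ => (r : ℤ) ∣ (d : ℤ) * ((ab.1 : ℤ) - ab.2 * k)) := by
  rw [Sd, Scount₂]
  congr 1
  exact filter_congr fun ab _ => (dvd_mul_iff_div_gcd_dvd hr _).symm

/-- **P3** (`d > Δ`, the divisor count): with `#rootsCube ≤ C_r q^ε`, `τ(n) ≤ C_d n^{ε'}`, `d(A+M), d(B+M)`-free
form: if `A + M ≤ L`, `B + M ≤ L` then
`∑_{(r,k)} S_d(r,k) ≤ (U₁ U₂) · C_r Q^ε · C_d (24 L³)^{ε'}`, `U_i = Uside · M d`.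
[cite: HeathBrown2001LargestPrimeFactorCubic, §7 (7.6) p. 26] -/
theorem sum_P3_le {Cr Cd ε ε' : ℝ} (hCr : 0 ≤ Cr) (hCd : 0 ≤ Cd) (hε : 0 ≤ ε) (hε' : 0 ≤ ε')
    (hroot : ∀ q : ℕ, q ≠ 0 → (#(rootsCube q) : ℝ) ≤ Cr * (q : ℝ) ^ ε)
    (hdiv : ∀ n : ℕ, n ≠ 0 → (#n.divisors : ℝ) ≤ Cd * (n : ℝ) ^ ε')
    {Q d A B M L : ℕ} (hd : 0 < d) (hAL : A + M ≤ L) (hBL : B + M ≤ L) :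
    ∑ qk ∈ rootPairs Q, (Sd A B M qk.1 qk.2 d : ℝ) ≤
      ((Uside A M d : ℝ) * Uside B M d) * (Cr * (Q : ℝ) ^ ε * (Cd * (24 * (L : ℝ) ^ 3) ^ ε')) := by
  classical
  set box := Ioc (A / d) (A / d + Uside A M d) ×ˢ Ioc (B / d) (B / d + Uside B M d) with hbox
  -- swap the two counts
  have hswap : ∑ qk ∈ rootPairs Q, (Sd A B M qk.1 qk.2 d : ℝ) =
      ∑ ab ∈ box, (#((rootPairs Q).filter fun qk => ((qk.1 : ℕ) : ℤ) ∣ (d : ℤ) * ((ab.1 : ℤ) - ab.2 * qk.2)) : ℝ) := by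
    have : ∀ qk ∈ rootPairs Q, (Sd A B M qk.1 qk.2 d : ℝ) =
        ∑ ab ∈ box, if ((qk.1 : ℕ) : ℤ) ∣ (d : ℤ) * ((ab.1 : ℤ) - ab.2 * qk.2) then (1 : ℝ) else 0 := by
      intro qk hqk
      rw [Sd_eq_card _ _ _ _ _ _ (rootPairs_bounds hqk).1, ← hbox]
      rw [card_filter]; push_cast; rfl
    rw [sum_congr rfl this, sum_comm]
    refine sum_congr rfl fun ab _ => ?_
    rw [card_filter]; push_cast; rfl
  rw [hswap]
  -- each count by `card_rootPairs_dvd_le` with `(ν, d') = (d b₁, d a₁)`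
  have hcount : ∀ ab ∈ box, (#((rootPairs Q).filter fun qk => ((qk.1 : ℕ) : ℤ) ∣ (d : ℤ) * ((ab.1 : ℤ) - ab.2 * qk.2)) : ℝ) ≤
      Cr * (Q : ℝ) ^ ε * (Cd * (24 * (L : ℝ) ^ 3) ^ ε') := by
    intro ab hab
    rw [hbox, mem_product, mem_Ioc, mem_Ioc] at hab
    obtain ⟨⟨ha1, ha2⟩, hb1, hb2⟩ := hab
    have hA0 : 0 ≤ A / d := Nat.zero_le _
    have ha0 : 1 ≤ ab.1 := by omega
    -- rewrite the divisibility as `r ∣ ν k − d'`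
    have hset : ((rootPairs Q).filter fun qk => ((qk.1 : ℕ) : ℤ) ∣ (d : ℤ) * ((ab.1 : ℤ) - ab.2 * qk.2)) =
        (rootPairs Q).filter fun qk => ((qk.1 : ℕ) : ℤ) ∣ ((d * ab.2 : ℕ) : ℤ) * qk.2 - ((d * ab.1 : ℕ) : ℤ) := by
      refine filter_congr fun qk _ => ?_
      rw [show ((d * ab.2 : ℕ) : ℤ) * qk.2 - ((d * ab.1 : ℕ) : ℤ) = -((d : ℤ) * ((ab.1 : ℤ) - ab.2 * qk.2)) by push_cast; ring,
        dvd_neg]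
    rw [hset]
    have hne : ¬ (((d * ab.2 : ℕ) : ℤ) = 0 ∧ ((d * ab.1 : ℕ) : ℤ) = 0) := by
      rintro ⟨-, h⟩
      have : d * ab.1 ≠ 0 := Nat.mul_ne_zero hd.ne' (by omega)
      exact this (by exact_mod_cast h)
    refine (card_rootPairs_dvd_le hCr hε hroot Q hne).trans ?_
    refine mul_le_mul_of_nonneg_left ?_ (by positivity)
    -- `τ(n) ≤ C_d n^{ε'}`, `n = |(d a₁)³ − 2 (d b₁)³| ≤ 24 L³`
    set n : ℕ := ((((d * ab.1 : ℕ) : ℤ)) ^ 3 - 2 * (((d * ab.2 : ℕ) : ℤ)) ^ 3).natAbs with hn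
    have hn0 : n ≠ 0 := by
      rw [hn]; refine Int.natAbs_ne_zero.mpr (cube_sub_two_mul_cube_ne_zero ?_)
      rintro ⟨-, h⟩
      have : d * ab.1 ≠ 0 := Nat.mul_ne_zero hd.ne' (by omega)
      exact this (by exact_mod_cast h)
    have hda : d * ab.1 ≤ L := by
      -- `ab.1 ≤ A/d + U = (A+M)/d`, so `d ab.1 ≤ A + M ≤ L`
      have h1 : ab.1 ≤ (A + M) / d := by
        have := ha2; rw [Uside, Nat.add_sub_cancel' (Nat.div_le_div_right (Nat.le_add_right A M))] at this; exact this
      calc d * ab.1 ≤ d * ((A + M) / d) := Nat.mul_le_mul_left d h1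
        _ ≤ A + M := Nat.mul_div_le (A + M) d
        _ ≤ L := hAL
    have hdb : d * ab.2 ≤ L := by
      have h1 : ab.2 ≤ (B + M) / d := by
        have := hb2; rw [Uside, Nat.add_sub_cancel' (Nat.div_le_div_right (Nat.le_add_right B M))] at this; exact this
      calc d * ab.2 ≤ d * ((B + M) / d) := Nat.mul_le_mul_left d h1
        _ ≤ B + M := Nat.mul_div_le (B + M) d
        _ ≤ L := hBL
    have hnle : (n : ℝ) ≤ 24 * (L : ℝ) ^ 3 := by
      have hz : (n : ℤ) = |(((d * ab.1 : ℕ) : ℤ)) ^ 3 - 2 * (((d * ab.2 : ℕ) : ℤ)) ^ 3| := by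
        rw [hn, Int.natCast_natAbs]
      have h2 : (n : ℝ) = |((d : ℝ) * ab.1) ^ 3 - 2 * ((d : ℝ) * ab.2) ^ 3| := by
        have := congrArg (Int.cast : ℤ → ℝ) hz
        push_cast at this
        exact this
      rw [h2]
      have hx : (d : ℝ) * ab.1 ≤ L := by exact_mod_cast hda
      have hy : (d : ℝ) * ab.2 ≤ L := by exact_mod_cast hdb
      have hx0 : (0 : ℝ) ≤ (d : ℝ) * ab.1 := by positivity
      have hy0 : (0 : ℝ) ≤ (d : ℝ) * ab.2 := by positivity
      rw [abs_le]
      constructor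
      · have : ((d : ℝ) * ab.2) ^ 3 ≤ (L : ℝ) ^ 3 := pow_le_pow_left₀ hy0 hy 3
        nlinarith [pow_nonneg hx0 3, pow_nonneg (Nat.cast_nonneg (α := ℝ) L) 3]
      · have : ((d : ℝ) * ab.1) ^ 3 ≤ (L : ℝ) ^ 3 := pow_le_pow_left₀ hx0 hx 3
        nlinarith [pow_nonneg hy0 3, pow_nonneg (Nat.cast_nonneg (α := ℝ) L) 3]
    calc (#(((((d * ab.1 : ℕ) : ℤ)) ^ 3 - 2 * (((d * ab.2 : ℕ) : ℤ)) ^ 3).natAbs.divisors) : ℝ)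
        = #(n.divisors) := by rw [hn]
      _ ≤ Cd * (n : ℝ) ^ ε' := hdiv n hn0
      _ ≤ Cd * (24 * (L : ℝ) ^ 3) ^ ε' := by gcongr
  calc ∑ ab ∈ box, (#((rootPairs Q).filter fun qk => ((qk.1 : ℕ) : ℤ) ∣ (d : ℤ) * ((ab.1 : ℤ) - ab.2 * qk.2)) : ℝ)
      ≤ ∑ _ab ∈ box, Cr * (Q : ℝ) ^ ε * (Cd * (24 * (L : ℝ) ^ 3) ^ ε') := sum_le_sum hcount
    _ = #box * (Cr * (Q : ℝ) ^ ε * (Cd * (24 * (L : ℝ) ^ 3) ^ ε')) := by rw [sum_const, nsmul_eq_mul]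
    _ = ((Uside A M d : ℝ) * Uside B M d) * (Cr * (Q : ℝ) ^ ε * (Cd * (24 * (L : ℝ) ^ 3) ^ ε')) := by
        rw [hbox, card_product, Nat.card_Ioc, Nat.card_Ioc, Nat.add_sub_cancel_left, Nat.add_sub_cancel_left]
        push_cast; ring

/-- **P4** (tail of the main term): `∑_{(r,k)} (M²/r)(2τ(r)/Δ) ≤ (2M²/Δ) C_r C_d Q^{ε+ε'} (1 + log Q)`.
[cite: HeathBrown2001LargestPrimeFactorCubic, §7 (7.5)] -/
theorem sum_P4_le {Cr Cd ε ε' : ℝ} (hCr : 0 ≤ Cr) (hCd : 0 ≤ Cd) (hε : 0 ≤ ε) (hε' : 0 ≤ ε')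
    (hroot : ∀ q : ℕ, q ≠ 0 → (#(rootsCube q) : ℝ) ≤ Cr * (q : ℝ) ^ ε)
    (hdiv : ∀ n : ℕ, n ≠ 0 → (#n.divisors : ℝ) ≤ Cd * (n : ℝ) ^ ε') {Q Δ : ℕ} (hΔ : 0 < Δ) (M : ℕ) :
    ∑ qk ∈ rootPairs Q, (M : ℝ) ^ 2 / qk.1 * (2 * (#(qk.1 : ℕ).divisors : ℝ) / Δ) ≤
      2 * (M : ℝ) ^ 2 / Δ * (Cr * Cd * (Q : ℝ) ^ (ε + ε') * (1 + Real.log Q)) := by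
  have hΔ' : (0 : ℝ) < Δ := by exact_mod_cast hΔ
  have h1 : ∑ qk ∈ rootPairs Q, (M : ℝ) ^ 2 / qk.1 * (2 * (#(qk.1 : ℕ).divisors : ℝ) / Δ) =
      2 * (M : ℝ) ^ 2 / Δ * ∑ qk ∈ rootPairs Q, (#(qk.1 : ℕ).divisors : ℝ) / qk.1 := by
    rw [mul_sum]; exact sum_congr rfl fun qk _ => by ring
  rw [h1]
  refine mul_le_mul_of_nonneg_left ?_ (by positivity)
  unfold rootPairs
  rw [sum_sigma]
  have h2 : ∑ r ∈ Icc 1 Q, ∑ _k ∈ rootsCube r, (#r.divisors : ℝ) / r = ∑ r ∈ Icc 1 Q, ((#(rootsCube r) : ℝ) * #r.divisors) / r := by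
    refine sum_congr rfl fun r _ => ?_
    rw [sum_const, nsmul_eq_mul, mul_div_assoc]
  rw [h2]
  have hQ0 : (0 : ℝ) ≤ Q := Nat.cast_nonneg Q
  calc ∑ r ∈ Icc 1 Q, ((#(rootsCube r) : ℝ) * #r.divisors) / r ≤ (Cr * Cd * (Q : ℝ) ^ (ε + ε')) * (1 + Real.log Q) := by
        refine sum_Icc_div_le_mul_log (fun r hr => ?_) (by positivity)
        rw [mem_Icc] at hr
        have hr0 : r ≠ 0 := by omega
        have hrQ : (r : ℝ) ≤ Q := by exact_mod_cast hr.2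
        calc (#(rootsCube r) : ℝ) * #r.divisors ≤ (Cr * (r : ℝ) ^ ε) * (Cd * (r : ℝ) ^ ε') :=
              mul_le_mul (hroot r hr0) (hdiv r hr0) (by positivity) (by positivity)
          _ ≤ (Cr * (Q : ℝ) ^ ε) * (Cd * (Q : ℝ) ^ ε') := by gcongr
          _ = Cr * Cd * (Q : ℝ) ^ (ε + ε') := by rw [Real.rpow_add_of_nonneg hQ0 hε hε']; ring
    _ = Cr * Cd * (Q : ℝ) ^ (ε + ε') * (1 + Real.log Q) := by ring


/-! ### Part D: the choice of `Δ` and Lemma 11 -/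

/-- `x/2 ≤ ⌊x⌋₊` for `x ≥ 1`. [folklore] -/
theorem half_le_nat_floor {x : ℝ} (hx : 1 ≤ x) : x / 2 ≤ (⌊x⌋₊ : ℝ) := by
  have h1 : x < (⌊x⌋₊ : ℝ) + 1 := Nat.lt_floor_add_one x
  have h2 : (1 : ℝ) ≤ (⌊x⌋₊ : ℝ) := by exact_mod_cast (Nat.le_floor (by exact_mod_cast hx) : 1 ≤ ⌊x⌋₊)
  linarith

/-- `√N/2 ≤ Nat.sqrt N` for `N ≥ 1`. [folklore] -/
theorem half_sqrt_le_nat_sqrt {N : ℕ} (hN : 1 ≤ N) : Real.sqrt N / 2 ≤ (Nat.sqrt N : ℝ) := by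
  have h1 : (N : ℝ) < ((Nat.sqrt N : ℝ) + 1) ^ 2 := by exact_mod_cast Nat.lt_succ_sqrt' N
  have h2 : (1 : ℝ) ≤ (Nat.sqrt N : ℝ) := by exact_mod_cast Nat.le_sqrt.mpr (by simpa using hN)
  have hs : Real.sqrt N < (Nat.sqrt N : ℝ) + 1 := by
    rw [show (Nat.sqrt N : ℝ) + 1 = Real.sqrt (((Nat.sqrt N : ℝ) + 1) ^ 2) by rw [Real.sqrt_sq (by positivity)]]
    exact Real.sqrt_lt_sqrt (Nat.cast_nonneg _) h1
  linarith

/-- `(Nat.sqrt N : ℝ) ≤ √N`. [folklore] -/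
theorem nat_sqrt_le_sqrt (N : ℕ) : (Nat.sqrt N : ℝ) ≤ Real.sqrt N := by
  rw [show (Nat.sqrt N : ℝ) = Real.sqrt (((Nat.sqrt N) ^ 2 : ℕ) : ℝ) by push_cast; rw [Real.sqrt_sq (Nat.cast_nonneg _)]]
  exact Real.sqrt_le_sqrt (by exact_mod_cast Nat.sqrt_le' N)

/-- Elementary sums over `d ≤ Δ`: `∑ σ(d)(M/d + 1) ≤ (1 + log Δ)(MΔ + Δ²)`, `∑ (2M/d+1)σ(d) ≤ (1+log Δ)(2MΔ + Δ²)`,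
`∑ τ(d) ≤ Δ(1 + log Δ)`, and over `d > Δ`: `∑_{Δ<d≤D} (M/d + 1)² ≤ 2M²/Δ + 2D`. [folklore] -/
theorem sums_over_d {Δ D M : ℕ} (hΔ : 0 < Δ) :
    (∑ d ∈ Icc 1 Δ, ((∑ s ∈ d.divisors, s : ℕ) : ℝ) * ((M : ℝ) / d + 1) ≤ (1 + Real.log Δ) * ((M : ℝ) * Δ + (Δ : ℝ) ^ 2)) ∧
    (∑ d ∈ Icc 1 Δ, (2 * ((M : ℝ) / d) + 1) * ((∑ s ∈ d.divisors, s : ℕ) : ℝ) ≤ (1 + Real.log Δ) * (2 * (M : ℝ) * Δ + (Δ : ℝ) ^ 2)) ∧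
    (∑ d ∈ Icc 1 Δ, (#d.divisors : ℝ) ≤ Δ * (1 + Real.log Δ)) ∧
    (∑ d ∈ Ioc Δ D, ((M : ℝ) / d + 1) ^ 2 ≤ 2 * (M : ℝ) ^ 2 / Δ + 2 * D) := by
  have hΔ' : (0 : ℝ) < Δ := by exact_mod_cast hΔ
  have hlogmono : ∀ d ∈ Icc 1 Δ, Real.log d ≤ Real.log Δ := by
    intro d hd; rw [mem_Icc] at hd
    exact Real.log_le_log (by exact_mod_cast hd.1) (by exact_mod_cast hd.2)
  have hσ : ∀ d ∈ Icc 1 Δ, ((∑ s ∈ d.divisors, s : ℕ) : ℝ) ≤ d * (1 + Real.log Δ) := by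
    intro d hd
    have hd' := hd; rw [mem_Icc] at hd'
    refine (sigma_one_le (by omega : 0 < d)).trans ?_
    have := hlogmono d hd
    have hd0 : (0 : ℝ) ≤ d := Nat.cast_nonneg d
    nlinarith
  have hlog0 : 0 ≤ 1 + Real.log Δ := by
    have := Real.log_nonneg (by exact_mod_cast hΔ : (1 : ℝ) ≤ Δ); linarith
  refine ⟨?_, ?_, ?_, ?_⟩
  · calc ∑ d ∈ Icc 1 Δ, ((∑ s ∈ d.divisors, s : ℕ) : ℝ) * ((M : ℝ) / d + 1)
        ≤ ∑ d ∈ Icc 1 Δ, (1 + Real.log Δ) * ((M : ℝ) + d) := by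
          refine sum_le_sum fun d hd => ?_
          have hd' := hd; rw [mem_Icc] at hd'
          have hd0 : (0 : ℝ) < d := by exact_mod_cast hd'.1
          calc ((∑ s ∈ d.divisors, s : ℕ) : ℝ) * ((M : ℝ) / d + 1) ≤ (d * (1 + Real.log Δ)) * ((M : ℝ) / d + 1) :=
                mul_le_mul_of_nonneg_right (hσ d hd) (by positivity)
            _ = (1 + Real.log Δ) * ((M : ℝ) + d) := by field_simp
      _ = (1 + Real.log Δ) * ∑ d ∈ Icc 1 Δ, ((M : ℝ) + d) := by rw [mul_sum]
      _ ≤ (1 + Real.log Δ) * ((M : ℝ) * Δ + (Δ : ℝ) ^ 2) := by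
          refine mul_le_mul_of_nonneg_left ?_ hlog0
          calc ∑ d ∈ Icc 1 Δ, ((M : ℝ) + d) ≤ ∑ _d ∈ Icc 1 Δ, ((M : ℝ) + Δ) := by
                refine sum_le_sum fun d hd => ?_
                rw [mem_Icc] at hd
                have : (d : ℝ) ≤ Δ := by exact_mod_cast hd.2
                linarith
            _ = Δ * ((M : ℝ) + Δ) := by rw [sum_const, Nat.card_Icc, nsmul_eq_mul]; push_cast; ring
            _ = (M : ℝ) * Δ + (Δ : ℝ) ^ 2 := by ring
  · calc ∑ d ∈ Icc 1 Δ, (2 * ((M : ℝ) / d) + 1) * ((∑ s ∈ d.divisors, s : ℕ) : ℝ)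
        ≤ ∑ d ∈ Icc 1 Δ, (1 + Real.log Δ) * (2 * (M : ℝ) + d) := by
          refine sum_le_sum fun d hd => ?_
          have hd' := hd; rw [mem_Icc] at hd'
          have hd0 : (0 : ℝ) < d := by exact_mod_cast hd'.1
          calc (2 * ((M : ℝ) / d) + 1) * ((∑ s ∈ d.divisors, s : ℕ) : ℝ) ≤ (2 * ((M : ℝ) / d) + 1) * (d * (1 + Real.log Δ)) :=
                mul_le_mul_of_nonneg_left (hσ d hd) (by positivity)
            _ = (1 + Real.log Δ) * (2 * (M : ℝ) + d) := by field_simp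
      _ = (1 + Real.log Δ) * ∑ d ∈ Icc 1 Δ, (2 * (M : ℝ) + d) := by rw [mul_sum]
      _ ≤ (1 + Real.log Δ) * (2 * (M : ℝ) * Δ + (Δ : ℝ) ^ 2) := by
          refine mul_le_mul_of_nonneg_left ?_ hlog0
          calc ∑ d ∈ Icc 1 Δ, (2 * (M : ℝ) + d) ≤ ∑ _d ∈ Icc 1 Δ, (2 * (M : ℝ) + Δ) := by
                refine sum_le_sum fun d hd => ?_
                rw [mem_Icc] at hd
                have : (d : ℝ) ≤ Δ := by exact_mod_cast hd.2
                linarith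
            _ = 2 * (M : ℝ) * Δ + (Δ : ℝ) ^ 2 := by rw [sum_const, Nat.card_Icc, nsmul_eq_mul]; push_cast; ring
  · exact sum_Icc_card_divisors_le Δ
  · have h1 : ∀ d ∈ Ioc Δ D, ((M : ℝ) / d + 1) ^ 2 ≤ 2 * ((M : ℝ) ^ 2 * (1 / (d : ℝ) ^ 2)) + 2 := by
      intro d hd
      rw [mem_Ioc] at hd
      have hd0 : (0 : ℝ) < d := by exact_mod_cast (hΔ.trans hd.1)
      have : ((M : ℝ) / d + 1) ^ 2 ≤ 2 * ((M : ℝ) / d) ^ 2 + 2 := by nlinarith [sq_nonneg ((M : ℝ) / d - 1)]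
      calc ((M : ℝ) / d + 1) ^ 2 ≤ 2 * ((M : ℝ) / d) ^ 2 + 2 := this
        _ = 2 * ((M : ℝ) ^ 2 * (1 / (d : ℝ) ^ 2)) + 2 := by rw [div_pow]; ring
    calc ∑ d ∈ Ioc Δ D, ((M : ℝ) / d + 1) ^ 2 ≤ ∑ d ∈ Ioc Δ D, (2 * ((M : ℝ) ^ 2 * (1 / (d : ℝ) ^ 2)) + 2) := sum_le_sum h1
      _ = 2 * (M : ℝ) ^ 2 * ∑ d ∈ Ioc Δ D, 1 / (d : ℝ) ^ 2 + 2 * #(Ioc Δ D) := by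
          rw [sum_add_distrib, sum_const, nsmul_eq_mul, ← mul_sum, ← mul_sum]; ring
      _ ≤ 2 * (M : ℝ) ^ 2 * (1 / Δ) + 2 * D := by
          gcongr
          · exact sum_Ioc_inv_sq_le hΔ D
          · have : #(Ioc Δ D) ≤ D := by rw [Nat.card_Ioc]; omega
            exact_mod_cast this
      _ = 2 * (M : ℝ) ^ 2 / Δ + 2 * D := by ring


set_option maxHeartbeats 4000000 in
/-- **Heath-Brown's Lemma 11 (root language)**: for every `ε > 0` there is `C > 0` such that for all
`N, Q` with `1 ≤ Q ≤ N²` and all boxes `(A, A+M] × (B, B+M]` with `A, B ≤ N`, `1 ≤ M ≤ N`,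
`∑_{(r,k) ∈ rootPairs Q} |T(r,k;A,B,M) − (6/π²) M² γ(r)/r| ≤ C (N √Q + N^{3/2}) N^ε`.
[cite: HeathBrown2001LargestPrimeFactorCubic, Lemma 11 pp. 25–27] -/
theorem exists_sum_rootPairs_abs_Tcount_sub_le {ε : ℝ} (hε : 0 < ε) :
    ∃ C : ℝ, 0 < C ∧ ∀ N Q : ℕ, 1 ≤ Q → (Q : ℝ) ≤ (N : ℝ) ^ 2 → ∀ A B M : ℕ, A ≤ N → B ≤ N → 1 ≤ M → M ≤ N →
      ∑ qk ∈ rootPairs Q, |(Tcount qk.1 qk.2 A B M : ℝ) - 6 / Real.pi ^ 2 * (M : ℝ) ^ 2 * gammaR qk.1 / qk.1| ≤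
        C * ((N : ℝ) * Real.sqrt Q + (N : ℝ) ^ ((3 : ℝ) / 2)) * (N : ℝ) ^ ε := by
  -- constants
  set θ : ℝ := ε / 12 with hθ
  have hθ0 : 0 < θ := by rw [hθ]; positivity
  obtain ⟨CL, hCL, hL10⟩ := exists_sum_rootPairs_abs_Scount₂_sub_le hθ0
  obtain ⟨Cr, hCr1, hCr⟩ := exists_card_rootsCube_le_rpow hθ0
  obtain ⟨Cd, hCd1, hCd⟩ := exists_card_divisors_le_mul_rpow hθ0
  have hCr0 : 0 ≤ Cr := by linarith
  have hCd0 : 0 ≤ Cd := by linarith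
  set Lg : ℝ := 1 + 1 / θ with hLg
  have hLg1 : 1 ≤ Lg := by rw [hLg]; have := one_div_pos.mpr hθ0; linarith
  -- one big constant
  have h192pos : (0 : ℝ) < (192 : ℝ) ^ θ := Real.rpow_pos_of_pos (by norm_num) θ
  set K : ℝ := 400 * ((CL + Cr + Cr * Cd * (192 : ℝ) ^ θ + Cr * Cd + 1) * (Lg * Lg)) with hK
  have hbase1 : (1 : ℝ) ≤ CL + Cr + Cr * Cd * (192 : ℝ) ^ θ + Cr * Cd + 1 := by
    nlinarith [mul_nonneg hCr0 hCd0, mul_nonneg (mul_nonneg hCr0 hCd0) h192pos.le]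
  have hK1 : 1 ≤ K := by
    rw [hK]
    have h1 : (1 : ℝ) ≤ (CL + Cr + Cr * Cd * (192 : ℝ) ^ θ + Cr * Cd + 1) * (Lg * Lg) :=
      one_le_mul_of_one_le_of_one_le hbase1 (one_le_mul_of_one_le_of_one_le hLg1 hLg1)
    nlinarith
  refine ⟨40 * K, by positivity, ?_⟩
  intro N Q hQ hQN A B M hAN hBN hM hMN
  have hN : 1 ≤ N := hM.trans hMN
  have hN0 : (0 : ℝ) < N := by exact_mod_cast hN
  have hN1 : (1 : ℝ) ≤ N := by exact_mod_cast hN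
  have hQ0 : (0 : ℝ) < Q := by exact_mod_cast hQ
  have hQ1 : (1 : ℝ) ≤ Q := by exact_mod_cast hQ
  have hM1 : (1 : ℝ) ≤ M := by exact_mod_cast hM
  have hMN' : (M : ℝ) ≤ N := by exact_mod_cast hMN
  -- the choice of `Δ`
  set Δ₀ : ℕ := min (Nat.sqrt N) ⌊(N : ℝ) / Real.sqrt Q⌋₊ with hΔ₀
  set Δ : ℕ := max 1 (min Δ₀ (A + M)) with hΔ
  have hΔ1 : 1 ≤ Δ := le_max_left _ _
  have hΔL : Δ ≤ A + M := by rw [hΔ]; exact max_le (by omega) (min_le_right _ _)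
  have hsqrtQ : 0 < Real.sqrt Q := Real.sqrt_pos.mpr hQ0
  have hNQ1 : (1 : ℝ) ≤ (N : ℝ) / Real.sqrt Q := by
    rw [le_div_iff₀ hsqrtQ, one_mul]
    calc Real.sqrt Q ≤ Real.sqrt ((N : ℝ) ^ 2) := Real.sqrt_le_sqrt hQN
      _ = N := Real.sqrt_sq hN0.le
  have hΔ₀1 : 1 ≤ Δ₀ := by
    rw [hΔ₀]; refine le_min (Nat.le_sqrt.mpr (by simpa using hN)) (Nat.le_floor (by exact_mod_cast hNQ1))
  have hΔle₀ : (Δ : ℝ) ≤ Δ₀ := by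
    have : Δ ≤ Δ₀ := by rw [hΔ]; exact max_le hΔ₀1 (min_le_left _ _)
    exact_mod_cast this
  have hΔsqrt : (Δ : ℝ) ≤ Real.sqrt N := by
    refine hΔle₀.trans ?_
    have : (Δ₀ : ℝ) ≤ (Nat.sqrt N : ℝ) := by exact_mod_cast min_le_left _ _
    exact this.trans (nat_sqrt_le_sqrt N)
  have hΔNQ : (Δ : ℝ) ≤ (N : ℝ) / Real.sqrt Q := by
    refine hΔle₀.trans ?_
    have : (Δ₀ : ℝ) ≤ (⌊(N : ℝ) / Real.sqrt Q⌋₊ : ℝ) := by exact_mod_cast min_le_right _ _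
    exact this.trans (Nat.floor_le (by positivity))
  have hsqrtN_le : Real.sqrt N ≤ N := by
    have := Real.sqrt_le_sqrt (show (N : ℝ) ≤ (N : ℝ) ^ 2 by nlinarith)
    rwa [Real.sqrt_sq hN0.le] at this
  have hΔN : (Δ : ℝ) ≤ N := hΔsqrt.trans hsqrtN_le
  have hΔ0 : (0 : ℝ) < Δ := by exact_mod_cast hΔ1
  -- `M²/Δ ≤ 2N^{3/2} + 2N√Q + N`
  have hM2Δ : (M : ℝ) ^ 2 / Δ ≤ 2 * (N : ℝ) ^ ((3 : ℝ) / 2) + 2 * N * Real.sqrt Q + N := by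
    have hN32 : (N : ℝ) ^ ((3 : ℝ) / 2) = N * Real.sqrt N := by
      rw [show (3 : ℝ) / 2 = 1 + 1 / 2 by norm_num, Real.rpow_add hN0, Real.rpow_one, Real.sqrt_eq_rpow]
    rcases le_or_gt Δ₀ (A + M) with hcase | hcase
    · -- `Δ = Δ₀ ≥ min(√N/2, (N/√Q)/2)`
      have hΔeq : Δ = Δ₀ := by rw [hΔ, min_eq_left hcase, max_eq_right hΔ₀1]
      have hsN := half_sqrt_le_nat_sqrt hN
      have hfl := half_le_nat_floor hNQ1
      -- `1/Δ₀ ≤ 2/√N + 2√Q/N`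
      have hinv : 1 / (Δ : ℝ) ≤ 2 / Real.sqrt N + 2 * Real.sqrt Q / N := by
        rw [hΔeq, hΔ₀]
        have hsqrtN : 0 < Real.sqrt N := Real.sqrt_pos.mpr hN0
        rcases le_total (Nat.sqrt N) ⌊(N : ℝ) / Real.sqrt Q⌋₊ with h | h
        · rw [min_eq_left h]
          have h0 : (0 : ℝ) < (Nat.sqrt N : ℝ) := by linarith [hsN, hsqrtN]
          calc 1 / (Nat.sqrt N : ℝ) ≤ 1 / (Real.sqrt N / 2) := one_div_le_one_div_of_le (by positivity) hsN
            _ = 2 / Real.sqrt N := by field_simp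
            _ ≤ 2 / Real.sqrt N + 2 * Real.sqrt Q / N := by
                have : 0 ≤ 2 * Real.sqrt Q / N := by positivity
                linarith
        · rw [min_eq_right h]
          have h0 : (0 : ℝ) < (⌊(N : ℝ) / Real.sqrt Q⌋₊ : ℝ) := by linarith [hfl, div_pos hN0 hsqrtQ]
          calc 1 / (⌊(N : ℝ) / Real.sqrt Q⌋₊ : ℝ) ≤ 1 / ((N : ℝ) / Real.sqrt Q / 2) :=
                one_div_le_one_div_of_le (by positivity) hfl
            _ = 2 * Real.sqrt Q / N := by field_simp
            _ ≤ 2 / Real.sqrt N + 2 * Real.sqrt Q / N := by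
                have : 0 ≤ 2 / Real.sqrt N := by positivity
                linarith
      have hsqrtN : 0 < Real.sqrt N := Real.sqrt_pos.mpr hN0
      calc (M : ℝ) ^ 2 / Δ = (M : ℝ) ^ 2 * (1 / Δ) := by ring
        _ ≤ (N : ℝ) ^ 2 * (2 / Real.sqrt N + 2 * Real.sqrt Q / N) := by
            apply mul_le_mul _ hinv (by positivity) (by positivity)
            exact pow_le_pow_left₀ (by positivity) hMN' 2
        _ = 2 * (N * (N / Real.sqrt N)) + 2 * N * Real.sqrt Q := by field_simp
        _ = 2 * (N * Real.sqrt N) + 2 * N * Real.sqrt Q := by rw [Real.div_sqrt]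
        _ ≤ 2 * (N : ℝ) ^ ((3 : ℝ) / 2) + 2 * N * Real.sqrt Q + N := by rw [hN32]; linarith
    · -- `Δ = A + M ≥ M`, so `M²/Δ ≤ M ≤ N`
      have hΔeq : Δ = A + M := by
        rw [hΔ, min_eq_right hcase.le, max_eq_right (by omega : 1 ≤ A + M)]
      have hMΔ : (M : ℝ) ≤ Δ := by rw [hΔeq]; push_cast; linarith [(Nat.cast_nonneg A : (0 : ℝ) ≤ A)]
      calc (M : ℝ) ^ 2 / Δ ≤ (M : ℝ) ^ 2 / M := div_le_div_of_nonneg_left (by positivity) (by positivity) hMΔ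
        _ = M := by field_simp
        _ ≤ 2 * (N : ℝ) ^ ((3 : ℝ) / 2) + 2 * N * Real.sqrt Q + N := by
            have : 0 ≤ (N : ℝ) ^ ((3 : ℝ) / 2) := by positivity
            have : 0 ≤ (N : ℝ) * Real.sqrt Q := by positivity
            linarith
  -- logarithms and powers
  have hlogN : 1 + Real.log N ≤ Lg * (N : ℝ) ^ θ := one_add_log_le hN hθ0
  have hlogΔ : 1 + Real.log Δ ≤ Lg * (N : ℝ) ^ θ := by
    have : Real.log Δ ≤ Real.log N := Real.log_le_log hΔ0 hΔN
    linarith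
  have hlogQ : 1 + Real.log Q ≤ Lg * (N : ℝ) ^ (2 * θ) := by
    have h1 := one_add_log_le hQ hθ0
    have h2 : (Q : ℝ) ^ θ ≤ ((N : ℝ) ^ 2) ^ θ := Real.rpow_le_rpow hQ0.le hQN hθ0.le
    rw [← Real.rpow_natCast, ← Real.rpow_mul hN0.le] at h2
    rw [show ((2 : ℕ) : ℝ) * θ = 2 * θ by push_cast; ring] at h2
    nlinarith [hLg1]
  have hQθ : (Q : ℝ) ^ θ ≤ (N : ℝ) ^ (2 * θ) := by
    have h2 : (Q : ℝ) ^ θ ≤ ((N : ℝ) ^ 2) ^ θ := Real.rpow_le_rpow hQ0.le hQN hθ0.le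
    rwa [← Real.rpow_natCast, ← Real.rpow_mul hN0.le, show ((2 : ℕ) : ℝ) * θ = 2 * θ by push_cast; ring] at h2
  have hQ2θ : (Q : ℝ) ^ (θ + θ) ≤ (N : ℝ) ^ (4 * θ) := by
    rw [Real.rpow_add hQ0, show 4 * θ = 2 * θ + 2 * θ by ring, Real.rpow_add hN0]
    exact mul_le_mul hQθ hQθ (by positivity) (by positivity)
  have hNpow : ∀ {a b : ℝ}, a ≤ b → (N : ℝ) ^ a ≤ (N : ℝ) ^ b := fun h => Real.rpow_le_rpow_of_exponent_le hN1 h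
  have hN1θ : (1 : ℝ) ≤ (N : ℝ) ^ θ := Real.one_le_rpow hN1 hθ0.le
  -- `(24 (2N)³)^θ = 192^θ N^{3θ}`
  have h192 : (24 * ((2 * N : ℕ) : ℝ) ^ 3) ^ θ = (192 : ℝ) ^ θ * (N : ℝ) ^ (3 * θ) := by
    have e : 24 * ((2 * N : ℕ) : ℝ) ^ 3 = 192 * (N : ℝ) ^ 3 := by push_cast; ring
    rw [e, Real.mul_rpow (by norm_num) (by positivity), ← Real.rpow_natCast (N : ℝ) 3, ← Real.rpow_mul hN0.le]
    rw [show ((3 : ℕ) : ℝ) * θ = 3 * θ by push_cast; ring]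
  -- the target quantity `Y = N√Q + N^{3/2}` and the elementary comparisons
  set Y : ℝ := (N : ℝ) * Real.sqrt Q + (N : ℝ) ^ ((3 : ℝ) / 2) with hY
  have hN32 : (N : ℝ) ^ ((3 : ℝ) / 2) = N * Real.sqrt N := by
    rw [show (3 : ℝ) / 2 = 1 + 1 / 2 by norm_num, Real.rpow_add hN0, Real.rpow_one, Real.sqrt_eq_rpow]
  have hY0 : 0 ≤ Y := by positivity
  have hNY : (N : ℝ) ≤ Y := by
    rw [hY, hN32]
    have : (N : ℝ) ≤ N * Real.sqrt N := le_mul_of_one_le_right hN0.le (Real.one_le_sqrt.mpr hN1)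
    have : 0 ≤ (N : ℝ) * Real.sqrt Q := by positivity
    linarith
  have hMΔY : (M : ℝ) * Δ ≤ Y := by
    rw [hY, hN32]
    have : (M : ℝ) * Δ ≤ N * Real.sqrt N := mul_le_mul hMN' hΔsqrt hΔ0.le hN0.le
    have : 0 ≤ (N : ℝ) * Real.sqrt Q := by positivity
    linarith
  have hΔ2Y : (Δ : ℝ) ^ 2 ≤ Y := by
    have : (Δ : ℝ) ^ 2 ≤ Real.sqrt N ^ 2 := pow_le_pow_left₀ hΔ0.le hΔsqrt 2
    rw [Real.sq_sqrt hN0.le] at this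
    exact this.trans hNY
  have hQΔY : (Q : ℝ) * Δ ≤ Y := by
    rw [hY]
    have h1 : (Q : ℝ) * Δ ≤ Q * ((N : ℝ) / Real.sqrt Q) := mul_le_mul_of_nonneg_left hΔNQ hQ0.le
    have h2 : (Q : ℝ) * ((N : ℝ) / Real.sqrt Q) = N * Real.sqrt Q := by
      have hQs : (Q : ℝ) = Real.sqrt Q * Real.sqrt Q := (Real.mul_self_sqrt hQ0.le).symm
      calc (Q : ℝ) * ((N : ℝ) / Real.sqrt Q) = (Real.sqrt Q * Real.sqrt Q) * ((N : ℝ) / Real.sqrt Q) := by rw [← hQs]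
        _ = N * Real.sqrt Q := by field_simp
    have : 0 ≤ (N : ℝ) ^ ((3 : ℝ) / 2) := by positivity
    linarith
  have hM2ΔY : (M : ℝ) ^ 2 / Δ ≤ 3 * Y := by rw [hY]; linarith [hM2Δ, hNY, hY.symm.le]
  -- Step 1: the per-pair decomposition, summed
  set P := rootPairs Q with hP
  have hPb : ∀ qk ∈ P, 0 < qk.1 ∧ qk.1 ≤ Q := fun qk h => rootPairs_bounds h
  have hstep1 : ∑ qk ∈ P, |(Tcount qk.1 qk.2 A B M : ℝ) - 6 / Real.pi ^ 2 * (M : ℝ) ^ 2 * gammaR qk.1 / qk.1| ≤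
      ∑ d ∈ Icc 1 Δ, ∑ qk ∈ P, |(Sd A B M qk.1 qk.2 d : ℝ) - (Uside A M d : ℝ) * (Uside B M d) / ((qk.1 / Nat.gcd qk.1 d : ℕ) : ℝ)| +
      ∑ d ∈ Icc 1 Δ, ∑ qk ∈ P, (2 * ((M : ℝ) / d) + 1) / ((qk.1 / Nat.gcd qk.1 d : ℕ) : ℝ) +
      ∑ d ∈ Ioc Δ (A + M), ∑ qk ∈ P, (Sd A B M qk.1 qk.2 d : ℝ) +
      ∑ qk ∈ P, (M : ℝ) ^ 2 / qk.1 * (2 * (#(qk.1 : ℕ).divisors : ℝ) / Δ) := by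
    rw [sum_comm (s := Icc 1 Δ), sum_comm (s := Icc 1 Δ) (t := P), sum_comm (s := Ioc Δ (A + M)),
      ← sum_add_distrib, ← sum_add_distrib, ← sum_add_distrib]
    exact sum_le_sum fun qk hqk => abs_Tcount_sub_main_le (hPb qk hqk).1 hΔ1 hΔL qk.2
  refine hstep1.trans ?_
  -- Step 2: the four pieces
  obtain ⟨hsumσ, hsumσ2, hsumτ, hsumIoc⟩ := sums_over_d (Δ := Δ) (D := A + M) (M := M) hΔ1
  have hUB : ∀ d ∈ Icc 1 Δ, (Uside B M d : ℝ) ≤ (M : ℝ) / d + 1 := by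
    intro d hd; rw [mem_Icc] at hd
    have := (abs_le.mp (abs_Uside_sub_le (by omega : 0 < d) B M)).2; linarith
  -- S1
  have hS1 : ∑ d ∈ Icc 1 Δ, ∑ qk ∈ P, |(Sd A B M qk.1 qk.2 d : ℝ) - (Uside A M d : ℝ) * (Uside B M d) / ((qk.1 / Nat.gcd qk.1 d : ℕ) : ℝ)| ≤
      CL * (Q : ℝ) ^ θ * ((1 + Real.log Δ) * ((M : ℝ) * Δ + (Δ : ℝ) ^ 2) + Δ * (1 + Real.log Δ) * Q) := by
    calc ∑ d ∈ Icc 1 Δ, ∑ qk ∈ P, |(Sd A B M qk.1 qk.2 d : ℝ) - (Uside A M d : ℝ) * (Uside B M d) / ((qk.1 / Nat.gcd qk.1 d : ℕ) : ℝ)|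
        ≤ ∑ d ∈ Icc 1 Δ, CL * (Q : ℝ) ^ θ * (((∑ s ∈ d.divisors, s : ℕ) : ℝ) * ((M : ℝ) / d + 1) + (#d.divisors : ℝ) * Q) := by
          refine sum_le_sum fun d hd => ?_
          have hd' := hd; rw [mem_Icc] at hd'
          refine (sum_P1_le hθ0 hCL hL10 hQ (by omega) A B M).trans ?_
          gcongr
          exact hUB d hd
      _ = CL * (Q : ℝ) ^ θ * (∑ d ∈ Icc 1 Δ, ((∑ s ∈ d.divisors, s : ℕ) : ℝ) * ((M : ℝ) / d + 1) +
            (∑ d ∈ Icc 1 Δ, (#d.divisors : ℝ)) * Q) := by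
          rw [← mul_sum, sum_add_distrib, sum_mul]
      _ ≤ CL * (Q : ℝ) ^ θ * ((1 + Real.log Δ) * ((M : ℝ) * Δ + (Δ : ℝ) ^ 2) + Δ * (1 + Real.log Δ) * Q) := by
          gcongr
  -- S2
  have hS2 : ∑ d ∈ Icc 1 Δ, ∑ qk ∈ P, (2 * ((M : ℝ) / d) + 1) / ((qk.1 / Nat.gcd qk.1 d : ℕ) : ℝ) ≤
      (1 + Real.log Δ) * (2 * (M : ℝ) * Δ + (Δ : ℝ) ^ 2) * (Cr * (Q : ℝ) ^ θ * (1 + Real.log Q)) := by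
    calc ∑ d ∈ Icc 1 Δ, ∑ qk ∈ P, (2 * ((M : ℝ) / d) + 1) / ((qk.1 / Nat.gcd qk.1 d : ℕ) : ℝ)
        ≤ ∑ d ∈ Icc 1 Δ, (2 * ((M : ℝ) / d) + 1) * ((∑ s ∈ d.divisors, s : ℕ) : ℝ) * (Cr * (Q : ℝ) ^ θ * (1 + Real.log Q)) := by
          refine sum_le_sum fun d hd => ?_
          rw [mem_Icc] at hd
          exact sum_P2_le hCr0 hθ0.le hCr (by omega) M
      _ = (∑ d ∈ Icc 1 Δ, (2 * ((M : ℝ) / d) + 1) * ((∑ s ∈ d.divisors, s : ℕ) : ℝ)) * (Cr * (Q : ℝ) ^ θ * (1 + Real.log Q)) := by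
          rw [sum_mul]
      _ ≤ (1 + Real.log Δ) * (2 * (M : ℝ) * Δ + (Δ : ℝ) ^ 2) * (Cr * (Q : ℝ) ^ θ * (1 + Real.log Q)) := by
          have hlogQ0 : 0 ≤ 1 + Real.log Q := by have := Real.log_nonneg hQ1; linarith
          gcongr
  -- S3
  have hS3 : ∑ d ∈ Ioc Δ (A + M), ∑ qk ∈ P, (Sd A B M qk.1 qk.2 d : ℝ) ≤
      (2 * (M : ℝ) ^ 2 / Δ + 2 * (A + M : ℕ)) * (Cr * (Q : ℝ) ^ θ * (Cd * ((192 : ℝ) ^ θ * (N : ℝ) ^ (3 * θ)))) := by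
    have hAL : A + M ≤ 2 * N := by omega
    have hBL : B + M ≤ 2 * N := by omega
    calc ∑ d ∈ Ioc Δ (A + M), ∑ qk ∈ P, (Sd A B M qk.1 qk.2 d : ℝ)
        ≤ ∑ d ∈ Ioc Δ (A + M), ((Uside A M d : ℝ) * Uside B M d) * (Cr * (Q : ℝ) ^ θ * (Cd * (24 * ((2 * N : ℕ) : ℝ) ^ 3) ^ θ)) := by
          refine sum_le_sum fun d hd => ?_
          rw [mem_Ioc] at hd
          exact sum_P3_le hCr0 hCd0 hθ0.le hθ0.le hCr hCd (by omega) hAL hBL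
      _ = (∑ d ∈ Ioc Δ (A + M), (Uside A M d : ℝ) * Uside B M d) * (Cr * (Q : ℝ) ^ θ * (Cd * ((192 : ℝ) ^ θ * (N : ℝ) ^ (3 * θ)))) := by
          rw [sum_mul, h192]
      _ ≤ (2 * (M : ℝ) ^ 2 / Δ + 2 * (A + M : ℕ)) * (Cr * (Q : ℝ) ^ θ * (Cd * ((192 : ℝ) ^ θ * (N : ℝ) ^ (3 * θ)))) := by
          gcongr
          refine le_trans (sum_le_sum fun d hd => ?_) hsumIoc
          rw [mem_Ioc] at hd
          have hd0 : 0 < d := by omega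
          have hUA := abs_Uside_sub_le hd0 A M
          have hUB' := abs_Uside_sub_le hd0 B M
          have h1 : (Uside A M d : ℝ) ≤ (M : ℝ) / d + 1 := by linarith [(abs_le.mp hUA).2]
          have h2 : (Uside B M d : ℝ) ≤ (M : ℝ) / d + 1 := by linarith [(abs_le.mp hUB').2]
          calc (Uside A M d : ℝ) * Uside B M d ≤ ((M : ℝ) / d + 1) * ((M : ℝ) / d + 1) :=
                mul_le_mul h1 h2 (Nat.cast_nonneg _) (by positivity)
            _ = ((M : ℝ) / d + 1) ^ 2 := by ring
  -- S4
  have hS4 := sum_P4_le hCr0 hCd0 hθ0.le hθ0.le hCr hCd (Q := Q) hΔ1 M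
  -- Step 3: replace logs and `Q`-powers by powers of `N`, and the shape quantities by `Y`
  have hlogΔ0 : 0 ≤ 1 + Real.log Δ := by have := Real.log_nonneg (by exact_mod_cast hΔ1 : (1:ℝ) ≤ Δ); linarith
  have hlogQ0 : 0 ≤ 1 + Real.log Q := by have := Real.log_nonneg hQ1; linarith
  have hNθ : 0 ≤ (N : ℝ) ^ θ := by positivity
  -- each piece `≤ const · N^{6θ} · Y`
  have hpow3 : (N : ℝ) ^ (2 * θ) * (N : ℝ) ^ θ ≤ (N : ℝ) ^ (6 * θ) := by
    rw [← Real.rpow_add hN0]; exact hNpow (by linarith)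
  have hpow5 : (N : ℝ) ^ (2 * θ) * (N : ℝ) ^ (2 * θ) * (N : ℝ) ^ θ ≤ (N : ℝ) ^ (6 * θ) := by
    rw [← Real.rpow_add hN0, ← Real.rpow_add hN0]; exact hNpow (by linarith)
  have hpow5' : (N : ℝ) ^ (2 * θ) * (N : ℝ) ^ (3 * θ) ≤ (N : ℝ) ^ (6 * θ) := by
    rw [← Real.rpow_add hN0]; exact hNpow (by linarith)
  have hpow6 : (N : ℝ) ^ (4 * θ) * (N : ℝ) ^ (2 * θ) ≤ (N : ℝ) ^ (6 * θ) := by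
    rw [← Real.rpow_add hN0]; exact hNpow (by linarith)
  have hB1 : CL * (Q : ℝ) ^ θ * ((1 + Real.log Δ) * ((M : ℝ) * Δ + (Δ : ℝ) ^ 2) + Δ * (1 + Real.log Δ) * Q) ≤
      3 * CL * Lg * (N : ℝ) ^ (6 * θ) * Y := by
    have h1 : (1 + Real.log Δ) * ((M : ℝ) * Δ + (Δ : ℝ) ^ 2) + Δ * (1 + Real.log Δ) * Q =
        (1 + Real.log Δ) * ((M : ℝ) * Δ + (Δ : ℝ) ^ 2 + Q * Δ) := by ring
    rw [h1]
    have h2 : (M : ℝ) * Δ + (Δ : ℝ) ^ 2 + Q * Δ ≤ 3 * Y := by linarith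
    calc CL * (Q : ℝ) ^ θ * ((1 + Real.log Δ) * ((M : ℝ) * Δ + (Δ : ℝ) ^ 2 + Q * Δ))
        ≤ CL * (N : ℝ) ^ (2 * θ) * ((Lg * (N : ℝ) ^ θ) * (3 * Y)) := by
          gcongr
      _ = 3 * CL * Lg * ((N : ℝ) ^ (2 * θ) * (N : ℝ) ^ θ) * Y := by ring
      _ ≤ 3 * CL * Lg * (N : ℝ) ^ (6 * θ) * Y := by gcongr
  have hB2 : (1 + Real.log Δ) * (2 * (M : ℝ) * Δ + (Δ : ℝ) ^ 2) * (Cr * (Q : ℝ) ^ θ * (1 + Real.log Q)) ≤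
      3 * Cr * Lg * Lg * (N : ℝ) ^ (6 * θ) * Y := by
    have h2 : 2 * (M : ℝ) * Δ + (Δ : ℝ) ^ 2 ≤ 3 * Y := by linarith
    calc (1 + Real.log Δ) * (2 * (M : ℝ) * Δ + (Δ : ℝ) ^ 2) * (Cr * (Q : ℝ) ^ θ * (1 + Real.log Q))
        ≤ (Lg * (N : ℝ) ^ θ) * (3 * Y) * (Cr * (N : ℝ) ^ (2 * θ) * (Lg * (N : ℝ) ^ (2 * θ))) := by
          gcongr
      _ = 3 * Cr * Lg * Lg * ((N : ℝ) ^ (2 * θ) * (N : ℝ) ^ (2 * θ) * (N : ℝ) ^ θ) * Y := by ring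
      _ ≤ 3 * Cr * Lg * Lg * (N : ℝ) ^ (6 * θ) * Y := by gcongr
  have hB3 : (2 * (M : ℝ) ^ 2 / Δ + 2 * (A + M : ℕ)) * (Cr * (Q : ℝ) ^ θ * (Cd * ((192 : ℝ) ^ θ * (N : ℝ) ^ (3 * θ)))) ≤
      10 * (Cr * Cd * (192 : ℝ) ^ θ) * (N : ℝ) ^ (6 * θ) * Y := by
    have h2 : 2 * (M : ℝ) ^ 2 / Δ + 2 * (A + M : ℕ) ≤ 10 * Y := by
      have : ((A + M : ℕ) : ℝ) ≤ 2 * N := by exact_mod_cast (show A + M ≤ 2 * N by omega)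
      have : 2 * (M : ℝ) ^ 2 / Δ = 2 * ((M : ℝ) ^ 2 / Δ) := by ring
      linarith
    calc (2 * (M : ℝ) ^ 2 / Δ + 2 * (A + M : ℕ)) * (Cr * (Q : ℝ) ^ θ * (Cd * ((192 : ℝ) ^ θ * (N : ℝ) ^ (3 * θ))))
        ≤ (10 * Y) * (Cr * (N : ℝ) ^ (2 * θ) * (Cd * ((192 : ℝ) ^ θ * (N : ℝ) ^ (3 * θ)))) := by gcongr
      _ = 10 * (Cr * Cd * (192 : ℝ) ^ θ) * ((N : ℝ) ^ (2 * θ) * (N : ℝ) ^ (3 * θ)) * Y := by ring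
      _ ≤ 10 * (Cr * Cd * (192 : ℝ) ^ θ) * (N : ℝ) ^ (6 * θ) * Y := by gcongr
  have hB4 : 2 * (M : ℝ) ^ 2 / Δ * (Cr * Cd * (Q : ℝ) ^ (θ + θ) * (1 + Real.log Q)) ≤
      6 * (Cr * Cd) * Lg * (N : ℝ) ^ (6 * θ) * Y := by
    have h2 : 2 * (M : ℝ) ^ 2 / Δ ≤ 6 * Y := by
      have : 2 * (M : ℝ) ^ 2 / Δ = 2 * ((M : ℝ) ^ 2 / Δ) := by ring
      linarith
    calc 2 * (M : ℝ) ^ 2 / Δ * (Cr * Cd * (Q : ℝ) ^ (θ + θ) * (1 + Real.log Q))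
        ≤ (6 * Y) * (Cr * Cd * (N : ℝ) ^ (4 * θ) * (Lg * (N : ℝ) ^ (2 * θ))) := by gcongr
      _ = 6 * (Cr * Cd) * Lg * ((N : ℝ) ^ (4 * θ) * (N : ℝ) ^ (2 * θ)) * Y := by ring
      _ ≤ 6 * (Cr * Cd) * Lg * (N : ℝ) ^ (6 * θ) * Y := by gcongr
  -- Step 4: collect
  have hN6 : (N : ℝ) ^ (6 * θ) ≤ (N : ℝ) ^ ε := hNpow (by rw [hθ]; linarith)
  have hN60 : 0 ≤ (N : ℝ) ^ (6 * θ) := by positivity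
  have hsum : 3 * CL * Lg * (N : ℝ) ^ (6 * θ) * Y + 3 * Cr * Lg * Lg * (N : ℝ) ^ (6 * θ) * Y +
      10 * (Cr * Cd * (192 : ℝ) ^ θ) * (N : ℝ) ^ (6 * θ) * Y + 6 * (Cr * Cd) * Lg * (N : ℝ) ^ (6 * θ) * Y ≤
      40 * K * Y * (N : ℝ) ^ ε := by
    have hcoef : 3 * CL * Lg + 3 * Cr * Lg * Lg + 10 * (Cr * Cd * (192 : ℝ) ^ θ) + 6 * (Cr * Cd) * Lg ≤ 40 * K := by
      rw [hK]
      have hLg2 : Lg ≤ Lg * Lg := le_mul_of_one_le_right (by linarith) hLg1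
      have h1 : 3 * CL * Lg ≤ 3 * CL * (Lg * Lg) := by gcongr
      have h2 : 6 * (Cr * Cd) * Lg ≤ 6 * (Cr * Cd) * (Lg * Lg) := by
        gcongr
      have h3 : 10 * (Cr * Cd * (192 : ℝ) ^ θ) ≤ 10 * (Cr * Cd * (192 : ℝ) ^ θ) * (Lg * Lg) :=
        le_mul_of_one_le_right (by positivity) (one_le_mul_of_one_le_of_one_le hLg1 hLg1)
      nlinarith [mul_nonneg hCr0 hCd0, mul_nonneg (mul_nonneg hCr0 hCd0) h192pos.le, hCL.le,
        mul_nonneg (by linarith : (0:ℝ) ≤ Lg) (by linarith : (0:ℝ) ≤ Lg)]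
    calc _ = (3 * CL * Lg + 3 * Cr * Lg * Lg + 10 * (Cr * Cd * (192 : ℝ) ^ θ) + 6 * (Cr * Cd) * Lg) * ((N : ℝ) ^ (6 * θ) * Y) := by ring
      _ ≤ (40 * K) * ((N : ℝ) ^ ε * Y) := by
          apply mul_le_mul hcoef _ (by positivity) (by positivity)
          exact mul_le_mul_of_nonneg_right hN6 hY0
      _ = 40 * K * Y * (N : ℝ) ^ ε := by ring
  rw [hY] at hsum
  linarith [hS1, hS2, hS3, hS4, hB1, hB2, hB3, hB4, hsum]


end Literature.NumberTheory.Sieve.HeathBrown2001
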